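import Literature.NumberTheory.Automorphic.ArchTorusOrbitalContinuity     -- ★ p839464 (F0P3a-p06 (g9)): global joint properness, `integrable_comp_conj_archDiagTorus`, `coe_archDiagTorus_eq_diagonal`
import Literature.NumberTheory.Automorphic.ArchTorusOneAngleCurve          -- ★ (V4): `hasDerivAt_coe_torusCurve`, `continuous_torusCurve`
import Literature.NumberTheory.Automorphic.ArchimedeanCalculus             -- ★ conventions: the scoped operator norm `Matrix.Norms.Operator` on `M_N(L ⊗ ℝ)`
import Mathlib.Analysis.Calculus.ParametricIntegral
import Mathlib.Analysis.Calculus.ContDiff.Deriv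
import HarnessLib

/-!
# The GLOBAL torus orbital function is `C¹` along the one-angle torus curves on the regular set: differentiation under the integral sign
# (ROAD-Sd (V2)-smooth; Rogawski 1990 §8.2–8.3 pp. 122–123: the limit formulas differentiate `ψ ↦ Φ(t(z(ψ)), f)`)

Topic `NumberTheory/Automorphic`; namespace `Literature.NumberTheory.Automorphic.UnitaryGroup`.  THEOREMS ONLY (no `def`, no instance, no notation, no axiom,
no `sorry`).  Cell `pub/hodgecm-mathlib`, ENGINE T1 (crux H413 = `stmt-HodgeConjecture-24833`); floor-1 preparation, count-neutral, under books rows #111 (S-d) ∕ #88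
(ST-∞) (ROAD-Sd §2 (V2)); author F0P3a-p07 (g6) (LEAD desk word T8-2 (4); the open offer of F0P3a-p06 (g9)).

SETTING.  `L` CM, `G′_∞ = U(diag α)(L⁺ ⊗ ℝ) ≤ GL_N(L ⊗ ℝ)` (★ `arch`, `α_i ≠ 0`), `t(z)` the diagonal torus in circle coordinates (★ `archDiagTorus`), `ν` a measure on
`G′_∞` finite on compacta.  TEST FUNCTIONS in the cell's ambient-smooth currency (★ `exists_smooth_lift_of_isArchTest`): `Θ : M_N(L ⊗ ℝ) → E` with `ContDiff ℝ 1 Θ`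
(operator norm of ★ `ArchimedeanCalculus`), read on the group as `k ↦ Θ ↑↑k`, with COMPACT SUPPORT ON THE GROUP.  THE CURVE: the global one-angle torus curve
`z_ψ = (z₀_{w,i} · e^{i c_{w,i} ψ})_{w,i}` (`c : W × N → ℝ`; ★ (V4) is the case of one place), its matrix `T(ψ) = ↑↑t(z_ψ) = diag(d(ψ))` (★ `coe_archDiagTorus_eq_diagonal`)
and the tangent `T′(ψ) = diag(d′(ψ))`, `d′(ψ)_i = (0, (z₀_{w,i} · e^{i c ψ} · i c_{w,i})_w)` (★ `hasDerivAt_coe_torusCurve`).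

* §1 `hasDerivAt_coe_archDiagTorus_curve` — `ψ ↦ T(ψ)` has derivative `T′(ψ)` in `M_N(L ⊗ ℝ)`; `coe_conj_arch` — `↑↑(g · t · g⁻¹) = ↑↑g · ↑↑t · ↑↑g⁻¹`;
  `hasDerivAt_apply_conj_archDiagTorus_curve` — for every `g ∈ G′_∞`, `ψ ↦ Θ(↑↑(g · t(z_ψ) · g⁻¹))` has derivative `DΘ(↑↑(g·t(z_ψ)·g⁻¹))[↑↑g · T′(ψ) · ↑↑g⁻¹]` (chain rule);
  `fderiv_apply_conj_archDiagTorus_curve_eq_zero` — that derivative term VANISHES when `g·t(z_ψ)·g⁻¹ ∉ tsupport (Θ ∘ ↑↑·)`;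
  `continuous_fderiv_apply_conj_archDiagTorus_curve` — it is jointly continuous in `(ψ, g)`.
* §2 `exists_closedBall_isCompact_fderiv_apply_conj_archDiagTorus_curve_eq_zero` — around a REGULAR `ψ₀` (`∀ w, Injective (z_{ψ₀} w)`) a closed ball of regular parameters
  and a COMPACT `S ⊆ G′_∞` off which the derivative term vanishes on the whole ball (★ `Literature.Topology.isOpen_setOf_forall_injective`, ★
  `isCompact_setOf_exists_conj_archDiagTorus_mem`); **`hasDerivAt_integral_comp_conj_archDiagTorus_curve`** — at every regular `ψ₀`:
  `d/dψ|_{ψ₀} ∫_{G′_∞} Θ(↑↑(g·t(z_ψ)·g⁻¹)) dν(g) = ∫_{G′_∞} DΘ(↑↑(g·t(z_{ψ₀})·g⁻¹))[↑↑g·T′(ψ₀)·↑↑g⁻¹] dν(g)` (and the right integrand is integrable) — Mathlib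
  `hasDerivAt_integral_of_dominated_loc_of_deriv_le`, domination `1_S · max B 0` with `B` the maximum of the derivative term on `closedBall × S`, integrability at `ψ₀` from ★
  `integrable_comp_conj_archDiagTorus`.
* §3 `continuousOn_integral_fderiv_apply_conj_archDiagTorus_curve` (the derivative is continuous on the regular `ψ`-set: Mathlib `continuousOn_integral_of_compact_support`),
  `deriv_integral_comp_conj_archDiagTorus_curve` (the `deriv` formula) and **`contDiffOn_one_integral_comp_conj_archDiagTorus_curve`**: the torus orbital function is `C¹` along
  the curve on the open set `{ψ | z_ψ regular}`.
NOT HERE: `C^∞` (iterate §2 on `fderiv ℝ Θ` under `ContDiff ℝ ⊤ Θ`), the singular set ((L-jump)), closed forms of the derivative.  HONEST LABEL: real analysis on a compact∕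
real group; HC_CM is proved only modulo the printed citations until rung 0 closes, and this file pays nothing by itself.

## References
* [Rogawski1990] J. D. Rogawski, *Automorphic Representations of Unitary Groups in Three Variables*, Ann. of Math. Stud. 123 (1990), §8.2–§8.3 pp. 122–123
  (the limit formulas differentiate the torus orbital integrals along one-parameter curves), §3.1 p. 19.
* [Shelstad1979] D. Shelstad, *Characters and inner forms of a quasi-split group over ℝ*, Compositio Math. 39 (1979), §4 (smoothness of `F_f` on `T_reg`).
* [Folland1995] G. B. Folland, *A Course in Abstract Harmonic Analysis* (1995), §2.6 (differentiation under the integral sign).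
-/

set_option autoImplicit false

noncomputable section

open MeasureTheory Measure NumberField NumberField.InfinitePlace NumberField.mixedEmbedding Filter Topology Set
open scoped Matrix MatrixGroups Real Classical

namespace Literature.NumberTheory.Automorphic.UnitaryGroup

-- the scoped operator norm on `M_N(L ⊗ ℝ)`, as in ★ `ArchimedeanCalculus`
open scoped Matrix.Norms.Operator

variable (L : Type) [Field L] [NumberField L] [IsCMField L] (N : ℕ) (α : Fin N → L)

/-! ## §1 The curve in the ambient matrix algebra and the chain rule -/

/-- **The diagonal torus along the one-angle curve has derivative `diag(d′(ψ))` in `M_N(L ⊗ ℝ)`** (★ `coe_archDiagTorus_eq_diagonal`; entrywise ★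
`hasDerivAt_coe_torusCurve`; `diagonal` is a continuous linear map of the entries). [cite: Rogawski1990, §8.2 p. 123] -/
theorem hasDerivAt_coe_archDiagTorus_curve (z₀ : {w : InfinitePlace L // IsComplex w} → Fin N → Circle)
    (c : {w : InfinitePlace L // IsComplex w} → Fin N → ℝ) (ψ : ℝ) :
    HasDerivAt (fun ψ : ℝ => (((archDiagTorus L N α fun w i => z₀ w i * Circle.exp (c w i * ψ) :
        arch (↥(maximalRealSubfield L)) L (IsCMField.complexConj L) N (Matrix.diagonal α)) : GL (Fin N) (mixedSpace L)) : Matrix (Fin N) (Fin N) (mixedSpace L)))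
      (Matrix.diagonal fun i => ((0 : {w : InfinitePlace L // IsReal w} → ℝ),
        fun w => (z₀ w i : ℂ) * (Complex.exp ((c w i * ψ : ℝ) * Complex.I) * ((c w i : ℂ) * Complex.I)))) ψ := by
  -- the entry vector `d(ψ)` and its derivative
  have hd : HasDerivAt (fun ψ : ℝ => fun i : Fin N => ((0 : {w : InfinitePlace L // IsReal w} → ℝ),
        fun w : {w : InfinitePlace L // IsComplex w} => ((z₀ w i * Circle.exp (c w i * ψ) : Circle) : ℂ)))
      (fun i => ((0 : {w : InfinitePlace L // IsReal w} → ℝ),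
        fun w => (z₀ w i : ℂ) * (Complex.exp ((c w i * ψ : ℝ) * Complex.I) * ((c w i : ℂ) * Complex.I)))) ψ := by
    refine hasDerivAt_pi.2 fun i => ?_
    refine (hasDerivAt_const ψ (0 : {w : InfinitePlace L // IsReal w} → ℝ)).prodMk ?_
    exact hasDerivAt_pi.2 fun w => hasDerivAt_coe_torusCurve (z₀ w) (c w) i ψ
  -- `diagonal` as a continuous linear map `(Fin N → L ⊗ ℝ) →L[ℝ] M_N(L ⊗ ℝ)`
  let D : (Fin N → mixedSpace L) →L[ℝ] Matrix (Fin N) (Fin N) (mixedSpace L) :=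
    LinearMap.toContinuousLinearMap (Matrix.diagonalLinearMap (Fin N) ℝ (mixedSpace L))
  have hD : ∀ d : Fin N → mixedSpace L, D d = Matrix.diagonal d := fun _ => rfl
  have hfun : (fun ψ : ℝ => (((archDiagTorus L N α fun w i => z₀ w i * Circle.exp (c w i * ψ) :
        arch (↥(maximalRealSubfield L)) L (IsCMField.complexConj L) N (Matrix.diagonal α)) : GL (Fin N) (mixedSpace L)) : Matrix (Fin N) (Fin N) (mixedSpace L))) =
      fun ψ => D (fun i : Fin N => ((0 : {w : InfinitePlace L // IsReal w} → ℝ),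
        fun w : {w : InfinitePlace L // IsComplex w} => ((z₀ w i * Circle.exp (c w i * ψ) : Circle) : ℂ))) := by
    funext ψ
    rw [coe_archDiagTorus_eq_diagonal, hD]
  rw [hfun, ← hD]
  exact D.hasFDerivAt.comp_hasDerivAt ψ hd

/-- `↑↑(g · t · g⁻¹) = ↑↑g · ↑↑t · ↑↑g⁻¹` in `M_N(L ⊗ ℝ)`. [cite: BorelJacquetCorvallis1979, §4.1] -/
theorem coe_conj_arch (H : Matrix (Fin N) (Fin N) L) (g t : arch (↥(maximalRealSubfield L)) L (IsCMField.complexConj L) N H) :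
    (((g * t * g⁻¹ : arch (↥(maximalRealSubfield L)) L (IsCMField.complexConj L) N H) : GL (Fin N) (mixedSpace L)) : Matrix (Fin N) (Fin N) (mixedSpace L)) =
      ((g : GL (Fin N) (mixedSpace L)) : Matrix (Fin N) (Fin N) (mixedSpace L)) * ((t : GL (Fin N) (mixedSpace L)) : Matrix (Fin N) (Fin N) (mixedSpace L)) *
        (((g⁻¹ : arch (↥(maximalRealSubfield L)) L (IsCMField.complexConj L) N H) : GL (Fin N) (mixedSpace L)) : Matrix (Fin N) (Fin N) (mixedSpace L)) := by
  rw [Subgroup.coe_mul, Subgroup.coe_mul, Units.val_mul, Units.val_mul]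

variable {E : Type*} [NormedAddCommGroup E] [NormedSpace ℝ E]

/-- **Chain rule along the conjugated curve**: for `Θ` `C¹` on `M_N(L ⊗ ℝ)` and `g ∈ G′_∞`, `ψ ↦ Θ(↑↑g · T(ψ) · ↑↑g⁻¹)` has derivative
`DΘ(↑↑g · T(ψ) · ↑↑g⁻¹)[↑↑g · T′(ψ) · ↑↑g⁻¹]`. [cite: Rogawski1990, §8.2 p. 123] [cite: Folland1995, §2.6] -/
theorem hasDerivAt_apply_conj_archDiagTorus_curve (hα : ∀ i, α i ≠ 0) (Θ : Matrix (Fin N) (Fin N) (mixedSpace L) → E) (hΘ : ContDiff ℝ 1 Θ)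
    (z₀ : {w : InfinitePlace L // IsComplex w} → Fin N → Circle) (c : {w : InfinitePlace L // IsComplex w} → Fin N → ℝ)
    (g : arch (↥(maximalRealSubfield L)) L (IsCMField.complexConj L) N (Matrix.diagonal α)) (ψ : ℝ) :
    HasDerivAt (fun ψ : ℝ => Θ ((((g * archDiagTorus L N α (fun w i => z₀ w i * Circle.exp (c w i * ψ)) * g⁻¹ :
        arch (↥(maximalRealSubfield L)) L (IsCMField.complexConj L) N (Matrix.diagonal α)) : GL (Fin N) (mixedSpace L)) : Matrix (Fin N) (Fin N) (mixedSpace L))))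
      (fderiv ℝ Θ ((((g * archDiagTorus L N α (fun w i => z₀ w i * Circle.exp (c w i * ψ)) * g⁻¹ :
          arch (↥(maximalRealSubfield L)) L (IsCMField.complexConj L) N (Matrix.diagonal α)) : GL (Fin N) (mixedSpace L)) : Matrix (Fin N) (Fin N) (mixedSpace L)))
        (((g : GL (Fin N) (mixedSpace L)) : Matrix (Fin N) (Fin N) (mixedSpace L)) *
          (Matrix.diagonal fun i => ((0 : {w : InfinitePlace L // IsReal w} → ℝ),
            fun w => (z₀ w i : ℂ) * (Complex.exp ((c w i * ψ : ℝ) * Complex.I) * ((c w i : ℂ) * Complex.I)))) *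
          (((g⁻¹ : arch (↥(maximalRealSubfield L)) L (IsCMField.complexConj L) N (Matrix.diagonal α)) : GL (Fin N) (mixedSpace L)) : Matrix (Fin N) (Fin N) (mixedSpace L)))) ψ := by
  have _ := hα
  have h1 := ((hasDerivAt_coe_archDiagTorus_curve L N α z₀ c ψ).const_mul
    (((g : GL (Fin N) (mixedSpace L)) : Matrix (Fin N) (Fin N) (mixedSpace L)))).mul_const
    ((((g⁻¹ : arch (↥(maximalRealSubfield L)) L (IsCMField.complexConj L) N (Matrix.diagonal α)) : GL (Fin N) (mixedSpace L)) : Matrix (Fin N) (Fin N) (mixedSpace L)))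
  simp_rw [coe_conj_arch]
  exact ((hΘ.differentiable one_ne_zero) _).hasFDerivAt.comp_hasDerivAt ψ h1

/-- **Off the support the derivative term vanishes**: if `g · t(z_ψ) · g⁻¹ ∉ tsupport (Θ ∘ ↑↑·)` then `DΘ(↑↑(g·t(z_ψ)·g⁻¹))[↑↑g · T′(ψ) · ↑↑g⁻¹] = 0` — it is the
`ψ`-derivative (§1) of `ψ ↦ Θ(↑↑(g·t(z_ψ)·g⁻¹))`, which vanishes identically near `ψ`. [cite: Folland1995, §2.6] [cite: Rogawski1990, §8.2 p. 123] -/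
theorem fderiv_apply_conj_archDiagTorus_curve_eq_zero (hα : ∀ i, α i ≠ 0) (Θ : Matrix (Fin N) (Fin N) (mixedSpace L) → E) (hΘ : ContDiff ℝ 1 Θ)
    (z₀ : {w : InfinitePlace L // IsComplex w} → Fin N → Circle) (c : {w : InfinitePlace L // IsComplex w} → Fin N → ℝ)
    (g : arch (↥(maximalRealSubfield L)) L (IsCMField.complexConj L) N (Matrix.diagonal α)) (ψ : ℝ)
    (hg : g * archDiagTorus L N α (fun w i => z₀ w i * Circle.exp (c w i * ψ)) * g⁻¹ ∉ tsupport fun k : arch (↥(maximalRealSubfield L)) L (IsCMField.complexConj L) N (Matrix.diagonal α) =>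
      Θ (((k : GL (Fin N) (mixedSpace L)) : Matrix (Fin N) (Fin N) (mixedSpace L)))) :
    fderiv ℝ Θ (((g * archDiagTorus L N α (fun w i => z₀ w i * Circle.exp (c w i * ψ)) * g⁻¹ : arch (↥(maximalRealSubfield L)) L (IsCMField.complexConj L) N (Matrix.diagonal α)) : GL (Fin N) (mixedSpace L)) : Matrix (Fin N) (Fin N) (mixedSpace L))
          (((g : GL (Fin N) (mixedSpace L)) : Matrix (Fin N) (Fin N) (mixedSpace L)) * (Matrix.diagonal fun i => ((0 : {w : InfinitePlace L // IsReal w} → ℝ),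
            fun w => (z₀ w i : ℂ) * (Complex.exp ((c w i * ψ : ℝ) * Complex.I) * ((c w i : ℂ) * Complex.I)))) *
            (((g⁻¹ : arch (↥(maximalRealSubfield L)) L (IsCMField.complexConj L) N (Matrix.diagonal α)) : GL (Fin N) (mixedSpace L)) : Matrix (Fin N) (Fin N) (mixedSpace L))) = 0 := by
  -- the integrand vanishes near the point, hence `ψ' ↦ Θ(↑↑(g·t(z_ψ')·g⁻¹))` vanishes near `ψ`, hence its derivative there is `0`
  have hev : (fun k : arch (↥(maximalRealSubfield L)) L (IsCMField.complexConj L) N (Matrix.diagonal α) => Θ (((k : GL (Fin N) (mixedSpace L)) : Matrix (Fin N) (Fin N) (mixedSpace L)))) =ᶠ[𝓝 (g * archDiagTorus L N α (fun w i => z₀ w i * Circle.exp (c w i * ψ)) * g⁻¹)] 0 :=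
    notMem_tsupport_iff_eventuallyEq.1 hg
  have hzc_cont : Continuous fun ψ' : ℝ => fun w i => z₀ w i * Circle.exp (c w i * ψ') :=
    continuous_pi fun w => continuous_torusCurve (z₀ w) (c w)
  have hcurve : ContinuousAt (fun ψ' : ℝ => g * archDiagTorus L N α (fun w i => z₀ w i * Circle.exp (c w i * ψ')) * g⁻¹) ψ :=
    ((continuous_const.mul ((continuous_archDiagTorus L N α).comp hzc_cont)).mul continuous_const).continuousAt
  have hev' : (fun ψ' : ℝ => Θ (((g * archDiagTorus L N α (fun w i => z₀ w i * Circle.exp (c w i * ψ')) * g⁻¹ : arch (↥(maximalRealSubfield L)) L (IsCMField.complexConj L) N (Matrix.diagonal α)) : GL (Fin N) (mixedSpace L)) : Matrix (Fin N) (Fin N) (mixedSpace L))) =ᶠ[𝓝 ψ] fun _ => 0 := by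
    filter_upwards [hcurve.eventually hev] with ψ' hψ'
    exact hψ'
  exact (hasDerivAt_apply_conj_archDiagTorus_curve L N α hα Θ hΘ z₀ c g ψ).unique ((hasDerivAt_const ψ (0 : E)).congr_of_eventuallyEq hev')

/-- **Joint continuity of the derivative term** `(ψ, g) ↦ DΘ(↑↑(g·t(z_ψ)·g⁻¹))[↑↑g · T′(ψ) · ↑↑g⁻¹]` on `ℝ × G′_∞` (for `Θ` `C¹`: `DΘ` is continuous into the operator-norm
topology, evaluation is jointly continuous). [cite: Folland1995, §2.6] -/
theorem continuous_fderiv_apply_conj_archDiagTorus_curve (Θ : Matrix (Fin N) (Fin N) (mixedSpace L) → E) (hΘ : ContDiff ℝ 1 Θ)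
    (z₀ : {w : InfinitePlace L // IsComplex w} → Fin N → Circle) (c : {w : InfinitePlace L // IsComplex w} → Fin N → ℝ) :
    Continuous fun p : ℝ × arch (↥(maximalRealSubfield L)) L (IsCMField.complexConj L) N (Matrix.diagonal α) =>
      fderiv ℝ Θ (((p.2 * archDiagTorus L N α (fun w i => z₀ w i * Circle.exp (c w i * p.1)) * p.2⁻¹ : arch (↥(maximalRealSubfield L)) L (IsCMField.complexConj L) N (Matrix.diagonal α)) : GL (Fin N) (mixedSpace L)) : Matrix (Fin N) (Fin N) (mixedSpace L))
          (((p.2 : GL (Fin N) (mixedSpace L)) : Matrix (Fin N) (Fin N) (mixedSpace L)) * (Matrix.diagonal fun i => ((0 : {w : InfinitePlace L // IsReal w} → ℝ),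
            fun w => (z₀ w i : ℂ) * (Complex.exp ((c w i * p.1 : ℝ) * Complex.I) * ((c w i : ℂ) * Complex.I)))) *
            (((p.2⁻¹ : arch (↥(maximalRealSubfield L)) L (IsCMField.complexConj L) N (Matrix.diagonal α)) : GL (Fin N) (mixedSpace L)) : Matrix (Fin N) (Fin N) (mixedSpace L))) := by
  have hzc_cont : Continuous fun ψ' : ℝ => fun w i => z₀ w i * Circle.exp (c w i * ψ') :=
    continuous_pi fun w => continuous_torusCurve (z₀ w) (c w)
  have hpt : Continuous fun p : ℝ × arch (↥(maximalRealSubfield L)) L (IsCMField.complexConj L) N (Matrix.diagonal α) => (((p.2 * archDiagTorus L N α (fun w i => z₀ w i * Circle.exp (c w i * p.1)) * p.2⁻¹ : arch (↥(maximalRealSubfield L)) L (IsCMField.complexConj L) N (Matrix.diagonal α)) : GL (Fin N) (mixedSpace L)) : Matrix (Fin N) (Fin N) (mixedSpace L)) :=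
    (Units.continuous_val.comp continuous_subtype_val).comp
      ((continuous_snd.mul ((continuous_archDiagTorus L N α).comp (hzc_cont.comp continuous_fst))).mul continuous_snd.inv)
  have hd'cont : Continuous fun ψ : ℝ => (Matrix.diagonal fun i => ((0 : {w : InfinitePlace L // IsReal w} → ℝ),
            fun w => (z₀ w i : ℂ) * (Complex.exp ((c w i * ψ : ℝ) * Complex.I) * ((c w i : ℂ) * Complex.I)))) := by
    refine (LinearMap.toContinuousLinearMap (Matrix.diagonalLinearMap (Fin N) ℝ (mixedSpace L))).continuous.comp ?_
    refine continuous_pi fun i => continuous_const.prodMk (continuous_pi fun w => ?_)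
    exact continuous_const.mul (((Complex.continuous_ofReal.comp (continuous_const.mul continuous_id)).mul continuous_const).cexp.mul
      continuous_const)
  have hdir : Continuous fun p : ℝ × arch (↥(maximalRealSubfield L)) L (IsCMField.complexConj L) N (Matrix.diagonal α) => ((p.2 : GL (Fin N) (mixedSpace L)) : Matrix (Fin N) (Fin N) (mixedSpace L)) * (Matrix.diagonal fun i => ((0 : {w : InfinitePlace L // IsReal w} → ℝ),
            fun w => (z₀ w i : ℂ) * (Complex.exp ((c w i * p.1 : ℝ) * Complex.I) * ((c w i : ℂ) * Complex.I)))) *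
      (((p.2⁻¹ : arch (↥(maximalRealSubfield L)) L (IsCMField.complexConj L) N (Matrix.diagonal α)) : GL (Fin N) (mixedSpace L)) : Matrix (Fin N) (Fin N) (mixedSpace L)) :=
    (((Units.continuous_val.comp continuous_subtype_val).comp continuous_snd).mul (hd'cont.comp continuous_fst)).mul
      ((Units.continuous_val.comp continuous_subtype_val).comp continuous_snd.inv)
  exact ((hΘ.continuous_fderiv one_ne_zero).comp hpt).clm_apply hdir

/-! ## §2 Differentiation under the integral sign on the regular set -/

/-- **A regular parameter has a closed ball of regular parameters around it, off a COMPACT subset of `G′_∞` of which the derivative term vanishes on the whole ball**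
(the ball: the regular set is open, ★ `Literature.Topology.isOpen_setOf_forall_injective`; the compact set: ★ `isCompact_setOf_exists_conj_archDiagTorus_mem` for the
compact curve image of the ball; the vanishing: `fderiv_apply_conj_archDiagTorus_curve_eq_zero`). [cite: Rogawski1990, §8.2–§8.3 pp. 122–123] [cite: Shelstad1979, §4] -/
theorem exists_closedBall_isCompact_fderiv_apply_conj_archDiagTorus_curve_eq_zero (hα : ∀ i, α i ≠ 0) (Θ : Matrix (Fin N) (Fin N) (mixedSpace L) → E) (hΘ : ContDiff ℝ 1 Θ)
    (hfc : HasCompactSupport fun k : arch (↥(maximalRealSubfield L)) L (IsCMField.complexConj L) N (Matrix.diagonal α) =>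
      Θ (((k : GL (Fin N) (mixedSpace L)) : Matrix (Fin N) (Fin N) (mixedSpace L))))
    (z₀ : {w : InfinitePlace L // IsComplex w} → Fin N → Circle) (c : {w : InfinitePlace L // IsComplex w} → Fin N → ℝ)
    (ψ₀ : ℝ) (hz : ∀ w, Function.Injective (fun i => z₀ w i * Circle.exp (c w i * ψ₀))) :
    ∃ δ : ℝ, 0 < δ ∧ (∀ ψ ∈ Metric.closedBall ψ₀ δ, ∀ w, Function.Injective (fun i => z₀ w i * Circle.exp (c w i * ψ))) ∧
      ∃ S : Set (arch (↥(maximalRealSubfield L)) L (IsCMField.complexConj L) N (Matrix.diagonal α)), IsCompact S ∧ ∀ g ∉ S, ∀ ψ ∈ Metric.closedBall ψ₀ δ,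
        fderiv ℝ Θ (((g * archDiagTorus L N α (fun w i => z₀ w i * Circle.exp (c w i * ψ)) * g⁻¹ : arch (↥(maximalRealSubfield L)) L (IsCMField.complexConj L) N (Matrix.diagonal α)) : GL (Fin N) (mixedSpace L)) : Matrix (Fin N) (Fin N) (mixedSpace L))
          (((g : GL (Fin N) (mixedSpace L)) : Matrix (Fin N) (Fin N) (mixedSpace L)) * (Matrix.diagonal fun i => ((0 : {w : InfinitePlace L // IsReal w} → ℝ),
            fun w => (z₀ w i : ℂ) * (Complex.exp ((c w i * ψ : ℝ) * Complex.I) * ((c w i : ℂ) * Complex.I)))) *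
            (((g⁻¹ : arch (↥(maximalRealSubfield L)) L (IsCMField.complexConj L) N (Matrix.diagonal α)) : GL (Fin N) (mixedSpace L)) : Matrix (Fin N) (Fin N) (mixedSpace L))) = 0 := by
  have hzc_cont : Continuous fun ψ' : ℝ => fun w i => z₀ w i * Circle.exp (c w i * ψ') :=
    continuous_pi fun w => continuous_torusCurve (z₀ w) (c w)
  have hreg_open : IsOpen {z : {w : InfinitePlace L // IsComplex w} → Fin N → Circle | ∀ w, Function.Injective (z w)} :=
    Literature.Topology.isOpen_setOf_forall_injective
  obtain ⟨δ, hδ, hball⟩ : ∃ δ > 0, Metric.closedBall ψ₀ δ ⊆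
      (fun ψ' : ℝ => fun w i => z₀ w i * Circle.exp (c w i * ψ')) ⁻¹' {z | ∀ w, Function.Injective (z w)} := by
    obtain ⟨ε, hε, hεball⟩ := Metric.mem_nhds_iff.1 ((hreg_open.preimage hzc_cont).mem_nhds (show _ ∈ _ from hz))
    exact ⟨ε / 2, half_pos hε, (Metric.closedBall_subset_ball (half_lt_self hε)).trans hεball⟩
  have hKc : IsCompact ((fun ψ' : ℝ => fun w i => z₀ w i * Circle.exp (c w i * ψ')) '' Metric.closedBall ψ₀ δ) :=
    (isCompact_closedBall ψ₀ δ).image hzc_cont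
  have hKreg : (fun ψ' : ℝ => fun w i => z₀ w i * Circle.exp (c w i * ψ')) '' Metric.closedBall ψ₀ δ ⊆ {z | ∀ w, Function.Injective (z w)} := by
    rintro _ ⟨ψ, hψ, rfl⟩; exact hball hψ
  refine ⟨δ, hδ, fun ψ hψ => hball hψ, {g : arch (↥(maximalRealSubfield L)) L (IsCMField.complexConj L) N (Matrix.diagonal α) | ∃ z ∈ (fun ψ' : ℝ => fun w i => z₀ w i * Circle.exp (c w i * ψ')) '' Metric.closedBall ψ₀ δ,
    g * archDiagTorus L N α z * g⁻¹ ∈ tsupport fun k : arch (↥(maximalRealSubfield L)) L (IsCMField.complexConj L) N (Matrix.diagonal α) => Θ (((k : GL (Fin N) (mixedSpace L)) : Matrix (Fin N) (Fin N) (mixedSpace L)))},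
    isCompact_setOf_exists_conj_archDiagTorus_mem L N α hα hKc hKreg hfc.isCompact, fun g hg ψ hψ => ?_⟩
  exact fderiv_apply_conj_archDiagTorus_curve_eq_zero L N α hα Θ hΘ z₀ c g ψ fun h => hg ⟨_, ⟨ψ, hψ, rfl⟩, h⟩

variable [MeasurableSpace (arch (↥(maximalRealSubfield L)) L (IsCMField.complexConj L) N (Matrix.diagonal α))] [BorelSpace (arch (↥(maximalRealSubfield L)) L (IsCMField.complexConj L) N (Matrix.diagonal α))]

/-- **THE GLOBAL TORUS ORBITAL FUNCTION IS DIFFERENTIABLE ALONG THE ONE-ANGLE CURVES ON THE REGULAR SET, WITH THE DERIVATIVE UNDER THE INTEGRAL SIGN.**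
`Θ` `C¹` on `M_N(L ⊗ ℝ)` with compact support on `G′_∞`, `ν` finite on compacta, `z_{ψ₀}` regular:
`d/dψ|_{ψ₀} ∫ Θ(↑↑(g·t(z_ψ)·g⁻¹)) dν(g) = ∫ DΘ(↑↑(g·t(z_{ψ₀})·g⁻¹))[↑↑g·T′(ψ₀)·↑↑g⁻¹] dν(g)`, and the latter integrand is integrable.  Dominated differentiation
(Mathlib `hasDerivAt_integral_of_dominated_loc_of_deriv_le`) on the ball of `exists_closedBall_isCompact_fderiv_apply_conj_archDiagTorus_curve_eq_zero`, bound
`1_S · max B 0` with `B` the maximum of the jointly continuous derivative term (`continuous_fderiv_apply_conj_archDiagTorus_curve`) on `closedBall × S`; integrability at `ψ₀` is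
★ `integrable_comp_conj_archDiagTorus`. [cite: Rogawski1990, §8.2–§8.3 pp. 122–123] [cite: Shelstad1979, §4] [cite: Folland1995, §2.6] -/
theorem hasDerivAt_integral_comp_conj_archDiagTorus_curve (hα : ∀ i, α i ≠ 0)
    (ν : Measure (arch (↥(maximalRealSubfield L)) L (IsCMField.complexConj L) N (Matrix.diagonal α))) [IsFiniteMeasureOnCompacts ν]
    (Θ : Matrix (Fin N) (Fin N) (mixedSpace L) → E) (hΘ : ContDiff ℝ 1 Θ)
    (hfc : HasCompactSupport fun k : arch (↥(maximalRealSubfield L)) L (IsCMField.complexConj L) N (Matrix.diagonal α) =>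
      Θ (((k : GL (Fin N) (mixedSpace L)) : Matrix (Fin N) (Fin N) (mixedSpace L))))
    (z₀ : {w : InfinitePlace L // IsComplex w} → Fin N → Circle) (c : {w : InfinitePlace L // IsComplex w} → Fin N → ℝ)
    (ψ₀ : ℝ) (hz : ∀ w, Function.Injective (fun i => z₀ w i * Circle.exp (c w i * ψ₀))) :
    Integrable (fun g : arch (↥(maximalRealSubfield L)) L (IsCMField.complexConj L) N (Matrix.diagonal α) =>
      fderiv ℝ Θ (((g * archDiagTorus L N α (fun w i => z₀ w i * Circle.exp (c w i * ψ₀)) * g⁻¹ : arch (↥(maximalRealSubfield L)) L (IsCMField.complexConj L) N (Matrix.diagonal α)) : GL (Fin N) (mixedSpace L)) : Matrix (Fin N) (Fin N) (mixedSpace L))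
          (((g : GL (Fin N) (mixedSpace L)) : Matrix (Fin N) (Fin N) (mixedSpace L)) * (Matrix.diagonal fun i => ((0 : {w : InfinitePlace L // IsReal w} → ℝ),
            fun w => (z₀ w i : ℂ) * (Complex.exp ((c w i * ψ₀ : ℝ) * Complex.I) * ((c w i : ℂ) * Complex.I)))) *
            (((g⁻¹ : arch (↥(maximalRealSubfield L)) L (IsCMField.complexConj L) N (Matrix.diagonal α)) : GL (Fin N) (mixedSpace L)) : Matrix (Fin N) (Fin N) (mixedSpace L)))) ν ∧
    HasDerivAt (fun ψ : ℝ => ∫ g : arch (↥(maximalRealSubfield L)) L (IsCMField.complexConj L) N (Matrix.diagonal α),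
        Θ (((g * archDiagTorus L N α (fun w i => z₀ w i * Circle.exp (c w i * ψ)) * g⁻¹ : arch (↥(maximalRealSubfield L)) L (IsCMField.complexConj L) N (Matrix.diagonal α)) : GL (Fin N) (mixedSpace L)) : Matrix (Fin N) (Fin N) (mixedSpace L)) ∂ν)
      (∫ g : arch (↥(maximalRealSubfield L)) L (IsCMField.complexConj L) N (Matrix.diagonal α),
        fderiv ℝ Θ (((g * archDiagTorus L N α (fun w i => z₀ w i * Circle.exp (c w i * ψ₀)) * g⁻¹ : arch (↥(maximalRealSubfield L)) L (IsCMField.complexConj L) N (Matrix.diagonal α)) : GL (Fin N) (mixedSpace L)) : Matrix (Fin N) (Fin N) (mixedSpace L))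
          (((g : GL (Fin N) (mixedSpace L)) : Matrix (Fin N) (Fin N) (mixedSpace L)) * (Matrix.diagonal fun i => ((0 : {w : InfinitePlace L // IsReal w} → ℝ),
            fun w => (z₀ w i : ℂ) * (Complex.exp ((c w i * ψ₀ : ℝ) * Complex.I) * ((c w i : ℂ) * Complex.I)))) *
            (((g⁻¹ : arch (↥(maximalRealSubfield L)) L (IsCMField.complexConj L) N (Matrix.diagonal α)) : GL (Fin N) (mixedSpace L)) : Matrix (Fin N) (Fin N) (mixedSpace L))) ∂ν) ψ₀ := by
  -- abbreviations: the integrand `F` and its `ψ`-derivative `F'`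
  obtain ⟨F, hF⟩ : ∃ F : ℝ → arch (↥(maximalRealSubfield L)) L (IsCMField.complexConj L) N (Matrix.diagonal α) → E, F = fun ψ g =>
      Θ (((g * archDiagTorus L N α (fun w i => z₀ w i * Circle.exp (c w i * ψ)) * g⁻¹ : arch (↥(maximalRealSubfield L)) L (IsCMField.complexConj L) N (Matrix.diagonal α)) : GL (Fin N) (mixedSpace L)) : Matrix (Fin N) (Fin N) (mixedSpace L)) := ⟨_, rfl⟩
  obtain ⟨F', hF'⟩ : ∃ F' : ℝ → arch (↥(maximalRealSubfield L)) L (IsCMField.complexConj L) N (Matrix.diagonal α) → E, F' = fun ψ g =>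
      fderiv ℝ Θ (((g * archDiagTorus L N α (fun w i => z₀ w i * Circle.exp (c w i * ψ)) * g⁻¹ : arch (↥(maximalRealSubfield L)) L (IsCMField.complexConj L) N (Matrix.diagonal α)) : GL (Fin N) (mixedSpace L)) : Matrix (Fin N) (Fin N) (mixedSpace L))
          (((g : GL (Fin N) (mixedSpace L)) : Matrix (Fin N) (Fin N) (mixedSpace L)) * (Matrix.diagonal fun i => ((0 : {w : InfinitePlace L // IsReal w} → ℝ),
            fun w => (z₀ w i : ℂ) * (Complex.exp ((c w i * ψ : ℝ) * Complex.I) * ((c w i : ℂ) * Complex.I)))) *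
            (((g⁻¹ : arch (↥(maximalRealSubfield L)) L (IsCMField.complexConj L) N (Matrix.diagonal α)) : GL (Fin N) (mixedSpace L)) : Matrix (Fin N) (Fin N) (mixedSpace L))) := ⟨_, rfl⟩
  -- (1) pointwise derivatives (chain rule, §1) and joint continuity of `F'`
  have hderiv : ∀ g ψ, HasDerivAt (fun ψ => F ψ g) (F' ψ g) ψ := fun g ψ => by
    rw [hF, hF']
    exact hasDerivAt_apply_conj_archDiagTorus_curve L N α hα Θ hΘ z₀ c g ψ
  have hF'cont : Continuous (Function.uncurry F') := by
    rw [hF']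
    exact continuous_fderiv_apply_conj_archDiagTorus_curve L N α Θ hΘ z₀ c
  have hfcont : Continuous fun k : arch (↥(maximalRealSubfield L)) L (IsCMField.complexConj L) N (Matrix.diagonal α) => Θ (((k : GL (Fin N) (mixedSpace L)) : Matrix (Fin N) (Fin N) (mixedSpace L))) :=
    hΘ.continuous.comp (Units.continuous_val.comp continuous_subtype_val)
  -- (2) the ball of regular parameters and the compact set carrying `F'`
  obtain ⟨δ, hδ, -, S, hSc, hS⟩ := exists_closedBall_isCompact_fderiv_apply_conj_archDiagTorus_curve_eq_zero L N α hα Θ hΘ hfc z₀ c ψ₀ hz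
  have hF'zero : ∀ g, g ∉ S → ∀ ψ ∈ Metric.closedBall ψ₀ δ, F' ψ g = 0 := fun g hg ψ hψ => by
    rw [hF']
    exact hS g hg ψ hψ
  -- (3) a uniform bound on `closedBall × S` and the domination
  obtain ⟨B, hB⟩ := ((isCompact_closedBall ψ₀ δ).prod hSc).exists_bound_of_continuousOn hF'cont.continuousOn
  have h_bound : ∀ᵐ g ∂ν, ∀ ψ ∈ Metric.ball ψ₀ δ, ‖F' ψ g‖ ≤ S.indicator (fun _ => max B 0) g := by
    refine Eventually.of_forall fun g ψ hψ => ?_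
    have hψ' : ψ ∈ Metric.closedBall ψ₀ δ := Metric.ball_subset_closedBall hψ
    by_cases hg : g ∈ S
    · rw [Set.indicator_of_mem hg]
      exact (hB (ψ, g) ⟨hψ', hg⟩).trans (le_max_left _ _)
    · rw [hF'zero g hg ψ hψ', norm_zero, Set.indicator_of_notMem hg]
  have hbound_int : Integrable (S.indicator fun _ => max B 0) ν :=
    IntegrableOn.integrable_indicator (integrableOn_const (hSc.measure_lt_top.ne)) hSc.measurableSet
  -- (4) measurability ∕ integrability at `ψ₀`, and the dominated differentiation theorem
  have hF_meas : ∀ᶠ ψ in 𝓝 ψ₀, AEStronglyMeasurable (F ψ) ν := Eventually.of_forall fun ψ => by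
    rw [hF]
    exact (hfcont.comp ((continuous_id.mul continuous_const).mul continuous_id.inv)).aestronglyMeasurable
  have hF_int : Integrable (F ψ₀) ν := by
    rw [hF]
    exact integrable_comp_conj_archDiagTorus L N α hα ν hz (fun k : arch (↥(maximalRealSubfield L)) L (IsCMField.complexConj L) N (Matrix.diagonal α) => Θ (((k : GL (Fin N) (mixedSpace L)) : Matrix (Fin N) (Fin N) (mixedSpace L)))) hfcont hfc
  have hF'_meas : AEStronglyMeasurable (F' ψ₀) ν :=
    (hF'cont.comp (continuous_const.prodMk continuous_id)).aestronglyMeasurable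
  have h_diff : ∀ᵐ g ∂ν, ∀ ψ ∈ Metric.ball ψ₀ δ, HasDerivAt (fun ψ => F ψ g) (F' ψ g) ψ :=
    Eventually.of_forall fun g ψ _ => hderiv g ψ
  have hmain := hasDerivAt_integral_of_dominated_loc_of_deriv_le (Metric.ball_mem_nhds ψ₀ hδ) hF_meas hF_int hF'_meas h_bound hbound_int h_diff
  rw [hF, hF'] at hmain
  exact hmain

/-! ## §3 The derivative is continuous on the regular set: the torus orbital function is `C¹` along the curve there -/

/-- **The derivative term integrates to a function continuous on the regular parameter set** `{ψ | z_ψ regular}`: locally (on the ball of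
`exists_closedBall_isCompact_fderiv_apply_conj_archDiagTorus_curve_eq_zero`) the integrand is jointly continuous and carried by a fixed compact set, so Mathlib's
`continuousOn_integral_of_compact_support` applies. [cite: Rogawski1990, §8.2–§8.3 pp. 122–123] [cite: Shelstad1979, §4] -/
theorem continuousOn_integral_fderiv_apply_conj_archDiagTorus_curve (hα : ∀ i, α i ≠ 0)
    (ν : Measure (arch (↥(maximalRealSubfield L)) L (IsCMField.complexConj L) N (Matrix.diagonal α))) [IsFiniteMeasureOnCompacts ν]
    (Θ : Matrix (Fin N) (Fin N) (mixedSpace L) → E) (hΘ : ContDiff ℝ 1 Θ)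
    (hfc : HasCompactSupport fun k : arch (↥(maximalRealSubfield L)) L (IsCMField.complexConj L) N (Matrix.diagonal α) =>
      Θ (((k : GL (Fin N) (mixedSpace L)) : Matrix (Fin N) (Fin N) (mixedSpace L))))
    (z₀ : {w : InfinitePlace L // IsComplex w} → Fin N → Circle) (c : {w : InfinitePlace L // IsComplex w} → Fin N → ℝ) :
    ContinuousOn (fun ψ : ℝ => ∫ g : arch (↥(maximalRealSubfield L)) L (IsCMField.complexConj L) N (Matrix.diagonal α),
        fderiv ℝ Θ (((g * archDiagTorus L N α (fun w i => z₀ w i * Circle.exp (c w i * ψ)) * g⁻¹ : arch (↥(maximalRealSubfield L)) L (IsCMField.complexConj L) N (Matrix.diagonal α)) : GL (Fin N) (mixedSpace L)) : Matrix (Fin N) (Fin N) (mixedSpace L))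
          (((g : GL (Fin N) (mixedSpace L)) : Matrix (Fin N) (Fin N) (mixedSpace L)) * (Matrix.diagonal fun i => ((0 : {w : InfinitePlace L // IsReal w} → ℝ),
            fun w => (z₀ w i : ℂ) * (Complex.exp ((c w i * ψ : ℝ) * Complex.I) * ((c w i : ℂ) * Complex.I)))) *
            (((g⁻¹ : arch (↥(maximalRealSubfield L)) L (IsCMField.complexConj L) N (Matrix.diagonal α)) : GL (Fin N) (mixedSpace L)) : Matrix (Fin N) (Fin N) (mixedSpace L))) ∂ν)
      {ψ : ℝ | ∀ w, Function.Injective (fun i => z₀ w i * Circle.exp (c w i * ψ))} := by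
  intro ψ₀ hψ₀
  obtain ⟨δ, hδ, -, S, hSc, hS⟩ := exists_closedBall_isCompact_fderiv_apply_conj_archDiagTorus_curve_eq_zero L N α hα Θ hΘ hfc z₀ c ψ₀ hψ₀
  have hcont : ContinuousOn (fun ψ : ℝ => ∫ g : arch (↥(maximalRealSubfield L)) L (IsCMField.complexConj L) N (Matrix.diagonal α),
      fderiv ℝ Θ (((g * archDiagTorus L N α (fun w i => z₀ w i * Circle.exp (c w i * ψ)) * g⁻¹ : arch (↥(maximalRealSubfield L)) L (IsCMField.complexConj L) N (Matrix.diagonal α)) : GL (Fin N) (mixedSpace L)) : Matrix (Fin N) (Fin N) (mixedSpace L))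
          (((g : GL (Fin N) (mixedSpace L)) : Matrix (Fin N) (Fin N) (mixedSpace L)) * (Matrix.diagonal fun i => ((0 : {w : InfinitePlace L // IsReal w} → ℝ),
            fun w => (z₀ w i : ℂ) * (Complex.exp ((c w i * ψ : ℝ) * Complex.I) * ((c w i : ℂ) * Complex.I)))) *
            (((g⁻¹ : arch (↥(maximalRealSubfield L)) L (IsCMField.complexConj L) N (Matrix.diagonal α)) : GL (Fin N) (mixedSpace L)) : Matrix (Fin N) (Fin N) (mixedSpace L))) ∂ν) (Metric.closedBall ψ₀ δ) :=
    continuousOn_integral_of_compact_support hSc (continuous_fderiv_apply_conj_archDiagTorus_curve L N α Θ hΘ z₀ c).continuousOn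
      fun ψ g hψ hg => hS g hg ψ hψ
  exact (hcont.continuousAt (Metric.closedBall_mem_nhds ψ₀ hδ)).continuousWithinAt

/-- **The derivative of the torus orbital function along the curve, on the regular set**: `deriv (ψ ↦ ∫ Θ(↑↑(g·t(z_ψ)·g⁻¹)) dν) ψ₀ = ∫ DΘ(…)[↑↑g·T′(ψ₀)·↑↑g⁻¹] dν`
at every regular `ψ₀` (`hasDerivAt_integral_comp_conj_archDiagTorus_curve`). [cite: Rogawski1990, §8.2–§8.3 pp. 122–123] -/
theorem deriv_integral_comp_conj_archDiagTorus_curve (hα : ∀ i, α i ≠ 0)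
    (ν : Measure (arch (↥(maximalRealSubfield L)) L (IsCMField.complexConj L) N (Matrix.diagonal α))) [IsFiniteMeasureOnCompacts ν]
    (Θ : Matrix (Fin N) (Fin N) (mixedSpace L) → E) (hΘ : ContDiff ℝ 1 Θ)
    (hfc : HasCompactSupport fun k : arch (↥(maximalRealSubfield L)) L (IsCMField.complexConj L) N (Matrix.diagonal α) =>
      Θ (((k : GL (Fin N) (mixedSpace L)) : Matrix (Fin N) (Fin N) (mixedSpace L))))
    (z₀ : {w : InfinitePlace L // IsComplex w} → Fin N → Circle) (c : {w : InfinitePlace L // IsComplex w} → Fin N → ℝ)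
    (ψ₀ : ℝ) (hz : ∀ w, Function.Injective (fun i => z₀ w i * Circle.exp (c w i * ψ₀))) :
    deriv (fun ψ : ℝ => ∫ g : arch (↥(maximalRealSubfield L)) L (IsCMField.complexConj L) N (Matrix.diagonal α),
        Θ (((g * archDiagTorus L N α (fun w i => z₀ w i * Circle.exp (c w i * ψ)) * g⁻¹ : arch (↥(maximalRealSubfield L)) L (IsCMField.complexConj L) N (Matrix.diagonal α)) : GL (Fin N) (mixedSpace L)) : Matrix (Fin N) (Fin N) (mixedSpace L)) ∂ν) ψ₀ =
      ∫ g : arch (↥(maximalRealSubfield L)) L (IsCMField.complexConj L) N (Matrix.diagonal α),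
        fderiv ℝ Θ (((g * archDiagTorus L N α (fun w i => z₀ w i * Circle.exp (c w i * ψ₀)) * g⁻¹ : arch (↥(maximalRealSubfield L)) L (IsCMField.complexConj L) N (Matrix.diagonal α)) : GL (Fin N) (mixedSpace L)) : Matrix (Fin N) (Fin N) (mixedSpace L))
          (((g : GL (Fin N) (mixedSpace L)) : Matrix (Fin N) (Fin N) (mixedSpace L)) * (Matrix.diagonal fun i => ((0 : {w : InfinitePlace L // IsReal w} → ℝ),
            fun w => (z₀ w i : ℂ) * (Complex.exp ((c w i * ψ₀ : ℝ) * Complex.I) * ((c w i : ℂ) * Complex.I)))) *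
            (((g⁻¹ : arch (↥(maximalRealSubfield L)) L (IsCMField.complexConj L) N (Matrix.diagonal α)) : GL (Fin N) (mixedSpace L)) : Matrix (Fin N) (Fin N) (mixedSpace L))) ∂ν :=
  (hasDerivAt_integral_comp_conj_archDiagTorus_curve L N α hα ν Θ hΘ hfc z₀ c ψ₀ hz).2.deriv

/-- **THE GLOBAL TORUS ORBITAL FUNCTION IS `C¹` ALONG THE ONE-ANGLE TORUS CURVES ON THE REGULAR SET** `{ψ | z_ψ regular}` (open): differentiable there
(`hasDerivAt_integral_comp_conj_archDiagTorus_curve`) with continuous derivative (`continuousOn_integral_fderiv_apply_conj_archDiagTorus_curve`,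
`deriv_integral_comp_conj_archDiagTorus_curve`); Mathlib `contDiffOn_succ_iff_deriv_of_isOpen`.  The smoothness input of Rogawski's limit formulas [Rogawski1990, Prop. 8.3]
on the regular set. [cite: Rogawski1990, §8.2–§8.3 pp. 122–123] [cite: Shelstad1979, §4] [cite: Folland1995, §2.6] -/
theorem contDiffOn_one_integral_comp_conj_archDiagTorus_curve (hα : ∀ i, α i ≠ 0)
    (ν : Measure (arch (↥(maximalRealSubfield L)) L (IsCMField.complexConj L) N (Matrix.diagonal α))) [IsFiniteMeasureOnCompacts ν]
    (Θ : Matrix (Fin N) (Fin N) (mixedSpace L) → E) (hΘ : ContDiff ℝ 1 Θ)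
    (hfc : HasCompactSupport fun k : arch (↥(maximalRealSubfield L)) L (IsCMField.complexConj L) N (Matrix.diagonal α) =>
      Θ (((k : GL (Fin N) (mixedSpace L)) : Matrix (Fin N) (Fin N) (mixedSpace L))))
    (z₀ : {w : InfinitePlace L // IsComplex w} → Fin N → Circle) (c : {w : InfinitePlace L // IsComplex w} → Fin N → ℝ) :
    ContDiffOn ℝ 1 (fun ψ : ℝ => ∫ g : arch (↥(maximalRealSubfield L)) L (IsCMField.complexConj L) N (Matrix.diagonal α),
        Θ (((g * archDiagTorus L N α (fun w i => z₀ w i * Circle.exp (c w i * ψ)) * g⁻¹ : arch (↥(maximalRealSubfield L)) L (IsCMField.complexConj L) N (Matrix.diagonal α)) : GL (Fin N) (mixedSpace L)) : Matrix (Fin N) (Fin N) (mixedSpace L)) ∂ν)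
      {ψ : ℝ | ∀ w, Function.Injective (fun i => z₀ w i * Circle.exp (c w i * ψ))} := by
  have hzc_cont : Continuous fun ψ' : ℝ => fun w i => z₀ w i * Circle.exp (c w i * ψ') :=
    continuous_pi fun w => continuous_torusCurve (z₀ w) (c w)
  have hU : IsOpen {ψ : ℝ | ∀ w, Function.Injective (fun i => z₀ w i * Circle.exp (c w i * ψ))} :=
    (Literature.Topology.isOpen_setOf_forall_injective).preimage hzc_cont
  rw [show (1 : WithTop ℕ∞) = 0 + 1 from rfl, contDiffOn_succ_iff_deriv_of_isOpen hU]
  refine ⟨fun ψ₀ hψ₀ => (hasDerivAt_integral_comp_conj_archDiagTorus_curve L N α hα ν Θ hΘ hfc z₀ c ψ₀ hψ₀).2.differentiableAt.differentiableWithinAt,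
    fun h => (WithTop.zero_ne_top h).elim, ?_⟩
  rw [contDiffOn_zero]
  refine (continuousOn_integral_fderiv_apply_conj_archDiagTorus_curve L N α hα ν Θ hΘ hfc z₀ c).congr fun ψ₀ hψ₀ => ?_
  exact deriv_integral_comp_conj_archDiagTorus_curve L N α hα ν Θ hΘ hfc z₀ c ψ₀ hψ₀

end Literature.NumberTheory.Automorphic.UnitaryGroup

end
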